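import Summits.QuantumFields.YangMills.Theorems.BalabanUVNodesN15CurvedGluingCubeSmoothCut
import Summits.QuantumFields.YangMills.Theorems.BalabanUVNodesN15CurvedGluingCubeDressedGeneralRows
import HarnessLib

/-!
# Route «BalabanUVNodes» (cluster K4 «SpineRates»), Track-A DAG node N15 = NE2, BACKGROUND LAYER — THE DRESSED SMOOTH-CUT CUBE BY NAME: file 23's dressing run at `G₀ := M_{χ̃}N_□` with the forward∕backward
# jet, every hypothesis of files 23∕25 discharged from FILE 63's cut rows of `N_□` and the bump's letters (file 31): the dressed cube's two-sided entry 0 (FILE 63 `hGc`, FILE 58 `hG`), its left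
# entries `∇^±_μX` (FILE 58 `hDG`), and its own cut `M_{χ_□}X = X`

Cell `pub-ymgap`, seat `pub-ymgap-dag-n15-w3` (WIDTH SEAT 3∕3 on node N15, director-ym №197 ∕ HUMAN RULING D-0149; plan `W-SEAT-START-LIST.md` §n15 item 3 «LG-vector + background layers at
GENERAL small-field U» — thirty-fourth piece: the INTEGRATION of file 31 with files 23∕25).  `bears_on: R4∕N15 · K3⁷ SpineGivenEndpointR13SepCoPH (stmt-QuantumFields-20544)`.  Filed `--kind proof
--supports stmt-QuantumFields-20544 --as helper` — COUNT-NEUTRAL.  Theorems only; 0 `sorry`.  Imports BY NAME file 31 `…CurvedGluingCubeSmoothCut` (`hasMaj_smoothCut`, `hasMaj_fgrad∕bgrad_smoothCut`,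
`smoothCut_out`, `fgrad∕bgrad_smoothCut_out`, `smoothCut_in`) and file 25 `…CubeDressedGeneralRows` (`hasMaj_projO_dressedV_loc₂`, `projO_dressedV_cutoffs`; file 23 `hasMaj_dressedV_loc₂`,
`hasMaj_dressedV_pair`, `projO_some_dressedV`); nothing in the tree is modified.

WHY.  dag-n15-c's live-background knit (FILE 63 currency + file 32's defect gluing) needs per cube: the dressed cube's cut letter `M_{χ_□}X_□ ≤ 1_S1_S·β′e^{−δd}` (`hGc`), the input-localized
remainder row (n15-w4 `hasMaj_commOp_cubeOp_dressedV_in`), the locality defect and its row (file 33), and for the node's face (FILE 58) the left entries.  All of them are files 23∕25 at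
`G₀ := M_{χ̃}N_□`, `D_j := ∇_j∘G₀`; THIS FILE performs that instantiation ONCE, so the knit reads the dressed cube directly from FILE 63's inputs: cut rows `M_χN ≤ 1_S1_S·β`, `M_χ∇^±_μN ≤
1_S1_S·β₁`, the bump `χ̃ ≺ χ` (`|χ̃| ≤ 1`, `|∇^±χ̃| ≤ c̃`, support insertions), the input cut-off `N = NM_ψ`, the perturbation `V̂ ≤ Re^{−δ_Vd}`, and ONE smallness `β̄Rc_r² < 1` with
`β̄ = β + (β₁ + c̃β)` (the common bound of `G₀` and `∇^±G₀` file 23 asks for).  The jet relation `D_j = Dq_j∘G₀` holds by `rfl`.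

* §1 `hasMaj_smoothCut_flat` ∕ `hasMaj_jet_smoothCut_flat` (file 31's rows weakened to the common unlocalized bound `β̄e^{−δd}`), `jet_smoothCut_out` (the jet pieces' output cut-off, both signs);
* §2 ★★★ `hasMaj_smoothCutDressed_loc₂` (entry 0 of the dressed smooth-cut cube, two-sided: `X ≤ 1_S1_S·β̄(1 − β̄Rc_r²)⁻¹e^{−ρ₂d}`), ★ `mulOp_comp_smoothCutDressed` (`M_χX = X`: the dressed cube is its own
  cut — FILE 63's `hGc` is ★★★ itself), ★★ `hasMaj_fgrad_smoothCutDressed_loc₂` ∕ `hasMaj_bgrad_smoothCutDressed_loc₂` (left entries `∇^±_μX ≤ 1_S1_S·β̄(1 − β̄Rc_r²)⁻¹e^{−ρ₂d}`).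

HONEST FRAMING ∕ LIMITS.  Pure instantiation (no estimate beyond files 23∕25∕31); every input displayed (cut rows, bump letters and support insertions, input cut-off, `V̂`'s letter); nothing of
[B6]∕[B9] asserted ((2.36)–(2.38) p.229, (2.133) p.247, (3.42) p.397, (3.63)–(3.65) pp.402–403 = SHAPES ∕ MECHANISM).  NE2⁺ NOT PRINTED, NOT proved; N15 NOT discharged; counts of record UNMOVED
(typed 28∕28 · discharged 5∕27); one finite 𝕋⁴ at fixed ε — NOT infinite volume, NOT OS on ℝ⁴, NOT a mass gap, NOT Clay; R4 closes the conditional finite-𝕋⁴ rung `BalabanLadder.UV` only.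
-/

set_option autoImplicit false

noncomputable section
open scoped BigOperators
open Finset

namespace Summit.QuantumFields.YangMills.BalabanUVNodes.N15.CurvedSpecies

open Literature.MathematicalPhysics.QuantumFieldTheory.Balaban1983to89
open Literature.MathematicalPhysics.QuantumFieldTheory.Balaban1983to89.B11SectG (BlockNorm HasMaj RowSum)
open Literature.MathematicalPhysics.QuantumFieldTheory.Balaban1983to89.B6RandomWalk (Triangle254)
open Literature.MathematicalPhysics.QuantumFieldTheory.Balaban1983to89.B6Prop26Gluing (mulOp mulOp_apply ind ind_nonneg ind_le_one)
open Summit.QuantumFields.YangMills.BalabanUVNodes.N15.MatrixSpecies (liftBlk liftEquiv liftEquiv_apply liftEquiv_symm_apply)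
open Summit.QuantumFields.YangMills.BalabanUVNodes.N15.BackgroundLayer (fgrad bgrad stack projO blkPair bgPropV projO_none_comp_stack projO_some_comp_stack)

variable {X ι J : Type} [Fintype X] [DecidableEq X] [Fintype ι] [DecidableEq ι] [Fintype J] [DecidableEq J] {g : B6.Geometry} (blk : X → g.Site) (τ : J → X ≃ X) (n : ℝ)
  {σ cr : ℝ} {N : (X × ι → ℝ) →ₗ[ℝ] (X × ι → ℝ)} {V : ((X × ι) × Option (J ⊕ J) → ℝ) →ₗ[ℝ] (X × ι → ℝ)} {χX χtX ψX : X → ℝ} {S : Set g.Site} {β β₁ ct δ : ℝ}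

/-! ## §1 File 31's rows in file 23's unlocalized currency; the jet pieces' output cut-off -/

omit [DecidableEq X] [DecidableEq ι] [Fintype J] [DecidableEq J] in
/-- `ind S y·ind S y′·(ce) ≤ c̄e` for `0 ≤ c ≤ c̄`. [folklore] -/
theorem loc₂_le_flat {c cb : ℝ} (hc : 0 ≤ c) (hcb : c ≤ cb) (y y' : g.Site) :
    ind S y * ind S y' * (c * Real.exp (-(δ * g.dist y y'))) ≤ cb * Real.exp (-(δ * g.dist y y')) := by
  have h1 : ind S y * ind S y' ≤ 1 := by
    calc ind S y * ind S y' ≤ 1 * 1 := mul_le_mul (ind_le_one _ _) (ind_le_one _ _) (ind_nonneg _ _) zero_le_one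
      _ = 1 := one_mul _
  have h0 : 0 ≤ c * Real.exp (-(δ * g.dist y y')) := mul_nonneg hc (Real.exp_nonneg _)
  calc ind S y * ind S y' * (c * Real.exp (-(δ * g.dist y y'))) ≤ 1 * (c * Real.exp (-(δ * g.dist y y'))) :=
        mul_le_mul_of_nonneg_right h1 h0
    _ ≤ cb * Real.exp (-(δ * g.dist y y')) := by rw [one_mul]; exact mul_le_mul_of_nonneg_right hcb (Real.exp_nonneg _)

omit [DecidableEq X] [DecidableEq ι] [Fintype J] [DecidableEq J] in
/-- THE SMOOTH-CUT CUBE IN FILE 23's CURRENCY: `M_χ̃N ≤ β̄e^{−δd}`, `β̄ = β + (β₁ + c̃β)`. [cite: Balaban1984PropagatorsII, (2.38) p.229, (2.133) p.247 (shapes)] -/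
theorem hasMaj_smoothCut_flat (hβ : 0 ≤ β) (hβ₁ : 0 ≤ β₁) (hct : 0 ≤ ct) (hχt : ∀ x, |χtX x| ≤ 1)
    (hsub : mulOp (fun p : X × ι => χtX p.1) ∘ₗ mulOp (fun p : X × ι => χX p.1) = mulOp (fun p : X × ι => χtX p.1))
    (hcut : HasMaj (BlockNorm.ofBlocks g (liftBlk blk ι)) (BlockNorm.ofBlocks g (liftBlk blk ι)) (mulOp (fun p : X × ι => χX p.1) ∘ₗ N)
      (fun y y' => ind S y * ind S y' * (β * Real.exp (-(δ * g.dist y y'))))) :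
    HasMaj (BlockNorm.ofBlocks g (liftBlk blk ι)) (BlockNorm.ofBlocks g (liftBlk blk ι)) (mulOp (fun p : X × ι => χtX p.1) ∘ₗ N)
      (fun y y' => (β + (β₁ + ct * β)) * Real.exp (-(δ * g.dist y y'))) :=
  (hasMaj_smoothCut (liftBlk blk ι) (fun p => hχt p.1) hsub hcut).mono fun y y' => loc₂_le_flat hβ (by nlinarith) y y'

omit [DecidableEq X] [DecidableEq ι] [Fintype J] [DecidableEq J] in
/-- THE JET PIECES IN FILE 23's CURRENCY: `∇^±_μ(M_χ̃N) ≤ β̄e^{−δd}` for every `j = ±μ`. [cite: Balaban1984PropagatorsII, (2.38) p.229, (2.133)–(2.134) p.247 (shapes)] -/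
theorem hasMaj_jet_smoothCut_flat (hβ : 0 ≤ β) (hβ₁ : 0 ≤ β₁) (hct : 0 ≤ ct) (hχt : ∀ x, |χtX x| ≤ 1)
    (hdχt : ∀ μ p, |fgrad n (liftEquiv (τ μ) ι) (fun p : X × ι => χtX p.1) p| ≤ ct) (hdχtb : ∀ μ p, |bgrad n (liftEquiv (τ μ) ι) (fun p : X × ι => χtX p.1) p| ≤ ct)
    (hs : ∀ μ, mulOp ((fun p : X × ι => χtX p.1) ∘ (liftEquiv (τ μ) ι)) ∘ₗ mulOp (fun p : X × ι => χX p.1) = mulOp ((fun p : X × ι => χtX p.1) ∘ (liftEquiv (τ μ) ι)))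
    (hsb : ∀ μ, mulOp ((fun p : X × ι => χtX p.1) ∘ (liftEquiv (τ μ) ι).symm) ∘ₗ mulOp (fun p : X × ι => χX p.1) = mulOp ((fun p : X × ι => χtX p.1) ∘ (liftEquiv (τ μ) ι).symm))
    (hd : ∀ μ, mulOp (fgrad n (liftEquiv (τ μ) ι) (fun p : X × ι => χtX p.1)) ∘ₗ mulOp (fun p : X × ι => χX p.1) = mulOp (fgrad n (liftEquiv (τ μ) ι) (fun p : X × ι => χtX p.1)))
    (hdb : ∀ μ, mulOp (bgrad n (liftEquiv (τ μ) ι) (fun p : X × ι => χtX p.1)) ∘ₗ mulOp (fun p : X × ι => χX p.1) = mulOp (bgrad n (liftEquiv (τ μ) ι) (fun p : X × ι => χtX p.1)))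
    (hcut : HasMaj (BlockNorm.ofBlocks g (liftBlk blk ι)) (BlockNorm.ofBlocks g (liftBlk blk ι)) (mulOp (fun p : X × ι => χX p.1) ∘ₗ N)
      (fun y y' => ind S y * ind S y' * (β * Real.exp (-(δ * g.dist y y')))))
    (hcutF : ∀ μ, HasMaj (BlockNorm.ofBlocks g (liftBlk blk ι)) (BlockNorm.ofBlocks g (liftBlk blk ι)) (mulOp (fun p : X × ι => χX p.1) ∘ₗ (fgrad n (liftEquiv (τ μ) ι) ∘ₗ N))
      (fun y y' => ind S y * ind S y' * (β₁ * Real.exp (-(δ * g.dist y y')))))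
    (hcutB : ∀ μ, HasMaj (BlockNorm.ofBlocks g (liftBlk blk ι)) (BlockNorm.ofBlocks g (liftBlk blk ι)) (mulOp (fun p : X × ι => χX p.1) ∘ₗ (bgrad n (liftEquiv (τ μ) ι) ∘ₗ N))
      (fun y y' => ind S y * ind S y' * (β₁ * Real.exp (-(δ * g.dist y y'))))) (j : J ⊕ J) :
    HasMaj (BlockNorm.ofBlocks g (liftBlk blk ι)) (BlockNorm.ofBlocks g (liftBlk blk ι))
      (Sum.elim (fun μ => fgrad n (liftEquiv (τ μ) ι)) (fun μ => bgrad n (liftEquiv (τ μ) ι)) j ∘ₗ (mulOp (fun p : X × ι => χtX p.1) ∘ₗ N))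
      (fun y y' => (β + (β₁ + ct * β)) * Real.exp (-(δ * g.dist y y'))) := by
  have hle : β₁ + ct * β ≤ β + (β₁ + ct * β) := by linarith
  rcases j with μ | μ
  · rw [Sum.elim_inl]
    exact (hasMaj_fgrad_smoothCut (liftBlk blk ι) n (liftEquiv (τ μ) ι) hct (fun p => by simp only [Function.comp_apply, liftEquiv_apply]; exact hχt _) (hdχt μ) (hs μ) (hd μ)
      hcut (hcutF μ)).mono
      fun y y' => loc₂_le_flat (by positivity) hle y y'
  · rw [Sum.elim_inr]
    exact (hasMaj_bgrad_smoothCut (liftBlk blk ι) n (liftEquiv (τ μ) ι) hct (fun p => by simp only [Function.comp_apply, liftEquiv_symm_apply]; exact hχt _) (hdχtb μ) (hsb μ)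
      (hdb μ) hcut (hcutB μ)).mono
      fun y y' => loc₂_le_flat (by positivity) hle y y'

omit [Fintype X] [DecidableEq X] [Fintype ι] [DecidableEq ι] [Fintype J] [DecidableEq J] in
/-- THE JET PIECES' OUTPUT CUT-OFF: `M_χ∘∇^±_μ(M_χ̃N) = ∇^±_μ(M_χ̃N)` (file 31, both signs). [folklore] -/
theorem jet_smoothCut_out
    (hs : ∀ μ, mulOp ((fun p : X × ι => χtX p.1) ∘ (liftEquiv (τ μ) ι)) ∘ₗ mulOp (fun p : X × ι => χX p.1) = mulOp ((fun p : X × ι => χtX p.1) ∘ (liftEquiv (τ μ) ι)))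
    (hsb : ∀ μ, mulOp ((fun p : X × ι => χtX p.1) ∘ (liftEquiv (τ μ) ι).symm) ∘ₗ mulOp (fun p : X × ι => χX p.1) = mulOp ((fun p : X × ι => χtX p.1) ∘ (liftEquiv (τ μ) ι).symm))
    (hd : ∀ μ, mulOp (fgrad n (liftEquiv (τ μ) ι) (fun p : X × ι => χtX p.1)) ∘ₗ mulOp (fun p : X × ι => χX p.1) = mulOp (fgrad n (liftEquiv (τ μ) ι) (fun p : X × ι => χtX p.1)))
    (hdb : ∀ μ, mulOp (bgrad n (liftEquiv (τ μ) ι) (fun p : X × ι => χtX p.1)) ∘ₗ mulOp (fun p : X × ι => χX p.1) = mulOp (bgrad n (liftEquiv (τ μ) ι) (fun p : X × ι => χtX p.1)))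
    (hs' : ∀ μ, mulOp (fun p : X × ι => χX p.1) ∘ₗ mulOp ((fun p : X × ι => χtX p.1) ∘ (liftEquiv (τ μ) ι)) = mulOp ((fun p : X × ι => χtX p.1) ∘ (liftEquiv (τ μ) ι)))
    (hsb' : ∀ μ, mulOp (fun p : X × ι => χX p.1) ∘ₗ mulOp ((fun p : X × ι => χtX p.1) ∘ (liftEquiv (τ μ) ι).symm) = mulOp ((fun p : X × ι => χtX p.1) ∘ (liftEquiv (τ μ) ι).symm))
    (hd' : ∀ μ, mulOp (fun p : X × ι => χX p.1) ∘ₗ mulOp (fgrad n (liftEquiv (τ μ) ι) (fun p : X × ι => χtX p.1)) = mulOp (fgrad n (liftEquiv (τ μ) ι) (fun p : X × ι => χtX p.1)))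
    (hdb' : ∀ μ, mulOp (fun p : X × ι => χX p.1) ∘ₗ mulOp (bgrad n (liftEquiv (τ μ) ι) (fun p : X × ι => χtX p.1)) = mulOp (bgrad n (liftEquiv (τ μ) ι) (fun p : X × ι => χtX p.1)))
    (j : J ⊕ J) :
    mulOp (fun p : X × ι => χX p.1) ∘ₗ (Sum.elim (fun μ => fgrad n (liftEquiv (τ μ) ι)) (fun μ => bgrad n (liftEquiv (τ μ) ι)) j ∘ₗ (mulOp (fun p : X × ι => χtX p.1) ∘ₗ N)) =
      Sum.elim (fun μ => fgrad n (liftEquiv (τ μ) ι)) (fun μ => bgrad n (liftEquiv (τ μ) ι)) j ∘ₗ (mulOp (fun p : X × ι => χtX p.1) ∘ₗ N) := by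
  rcases j with μ | μ
  · rw [Sum.elim_inl]; exact fgrad_smoothCut_out n (liftEquiv (τ μ) ι) (hs μ) (hd μ) (hs' μ) (hd' μ)
  · rw [Sum.elim_inr]; exact bgrad_smoothCut_out n (liftEquiv (τ μ) ι) (hsb μ) (hdb μ) (hsb' μ) (hdb' μ)

/-! ## §2 The dressed smooth-cut cube: entry 0, its own cut, left entries -/

/-- ★★★ **ENTRY 0 OF THE DRESSED SMOOTH-CUT CUBE, TWO-SIDED** (FILE 63 `hGc` ∕ FILE 58 `hG` at a live background): FILE 63's cut rows of `N_□` (`β, β₁`), the bump `χ̃ ≺ χ_□` (`|χ̃| ≤ 1`,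
`|∇^±χ̃| ≤ c̃`, support insertions), the cuts' supports over `S`, `N_□ = N_□M_ψ`, the perturbation `V̂ ≤ Re^{−δ_Vd}`, rates as in file 23, `β̄Rc_r² < 1` (`β̄ = β + (β₁ + c̃β)`) ⟹
`X = pr₀((1 − ŜV̂)⁻¹Ŝ)`, `Ŝ = (M_χ̃N_□, (∇^±_μM_χ̃N_□)_μ)`, satisfies `X ≤ 1_S(y)1_S(y′)·β̄(1 − β̄Rc_r²)⁻¹e^{−ρ₂d}`. [cite: Balaban1984PropagatorsII, (2.36)–(2.38) p.229, (2.133) p.247 (shapes); Balaban1985BackgroundPropagators, (3.63)–(3.65) pp.402–403 (mechanism)] -/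
theorem hasMaj_smoothCutDressed_loc₂ (htri : Triangle254 g) (hd : ∀ a b : g.Site, 0 ≤ g.dist a b) (hrow : RowSum g σ cr) (hσ : 0 ≤ σ) {ρ₁ ρ₂ δV R : ℝ} (hβ : 0 ≤ β) (hβ₁ : 0 ≤ β₁)
    (hct : 0 ≤ ct) (hR : 0 ≤ R) (hcr : 0 ≤ cr) (hσρ : σ ≤ ρ₁) (hρ₁V : ρ₁ ≤ δV) (hρ₁G : ρ₁ + σ ≤ δ) (hρ₂ : 0 ≤ ρ₂) (hρ₂₁ : ρ₂ + σ ≤ ρ₁)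
    (hSχ : ∀ x, χX x ≠ 0 → blk x ∈ S) (hSψ : ∀ x, ψX x ≠ 0 → blk x ∈ S) (hχt : ∀ x, |χtX x| ≤ 1)
    (hdχt : ∀ μ p, |fgrad n (liftEquiv (τ μ) ι) (fun p : X × ι => χtX p.1) p| ≤ ct) (hdχtb : ∀ μ p, |bgrad n (liftEquiv (τ μ) ι) (fun p : X × ι => χtX p.1) p| ≤ ct)
    (hsub : mulOp (fun p : X × ι => χtX p.1) ∘ₗ mulOp (fun p : X × ι => χX p.1) = mulOp (fun p : X × ι => χtX p.1))
    (hχ : mulOp (fun p : X × ι => χX p.1) ∘ₗ mulOp (fun p : X × ι => χtX p.1) = mulOp (fun p : X × ι => χtX p.1))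
    (hs : ∀ μ, mulOp ((fun p : X × ι => χtX p.1) ∘ (liftEquiv (τ μ) ι)) ∘ₗ mulOp (fun p : X × ι => χX p.1) = mulOp ((fun p : X × ι => χtX p.1) ∘ (liftEquiv (τ μ) ι)))
    (hsb : ∀ μ, mulOp ((fun p : X × ι => χtX p.1) ∘ (liftEquiv (τ μ) ι).symm) ∘ₗ mulOp (fun p : X × ι => χX p.1) = mulOp ((fun p : X × ι => χtX p.1) ∘ (liftEquiv (τ μ) ι).symm))
    (hdd : ∀ μ, mulOp (fgrad n (liftEquiv (τ μ) ι) (fun p : X × ι => χtX p.1)) ∘ₗ mulOp (fun p : X × ι => χX p.1) = mulOp (fgrad n (liftEquiv (τ μ) ι) (fun p : X × ι => χtX p.1)))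
    (hddb : ∀ μ, mulOp (bgrad n (liftEquiv (τ μ) ι) (fun p : X × ι => χtX p.1)) ∘ₗ mulOp (fun p : X × ι => χX p.1) = mulOp (bgrad n (liftEquiv (τ μ) ι) (fun p : X × ι => χtX p.1)))
    (hNψ : N ∘ₗ mulOp (fun p : X × ι => ψX p.1) = N)
    (hcut : HasMaj (BlockNorm.ofBlocks g (liftBlk blk ι)) (BlockNorm.ofBlocks g (liftBlk blk ι)) (mulOp (fun p : X × ι => χX p.1) ∘ₗ N)
      (fun y y' => ind S y * ind S y' * (β * Real.exp (-(δ * g.dist y y')))))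
    (hcutF : ∀ μ, HasMaj (BlockNorm.ofBlocks g (liftBlk blk ι)) (BlockNorm.ofBlocks g (liftBlk blk ι)) (mulOp (fun p : X × ι => χX p.1) ∘ₗ (fgrad n (liftEquiv (τ μ) ι) ∘ₗ N))
      (fun y y' => ind S y * ind S y' * (β₁ * Real.exp (-(δ * g.dist y y')))))
    (hcutB : ∀ μ, HasMaj (BlockNorm.ofBlocks g (liftBlk blk ι)) (BlockNorm.ofBlocks g (liftBlk blk ι)) (mulOp (fun p : X × ι => χX p.1) ∘ₗ (bgrad n (liftEquiv (τ μ) ι) ∘ₗ N))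
      (fun y y' => ind S y * ind S y' * (β₁ * Real.exp (-(δ * g.dist y y')))))
    (hV : HasMaj (BlockNorm.ofBlocks g (blkPair (liftBlk blk ι))) (BlockNorm.ofBlocks g (liftBlk blk ι)) V (fun y y' => R * Real.exp (-(δV * g.dist y y'))))
    (hq : (β + (β₁ + ct * β)) * (R * cr) * cr < 1) :
    HasMaj (BlockNorm.ofBlocks g (liftBlk blk ι)) (BlockNorm.ofBlocks g (liftBlk blk ι))
      (projO none ∘ₗ bgPropV (stack (mulOp (fun p : X × ι => χtX p.1) ∘ₗ N)
        (fun j => Sum.elim (fun μ => fgrad n (liftEquiv (τ μ) ι)) (fun μ => bgrad n (liftEquiv (τ μ) ι)) j ∘ₗ (mulOp (fun p : X × ι => χtX p.1) ∘ₗ N))) V)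
      (fun y y' => ind S y * ind S y' * ((β + (β₁ + ct * β)) * (1 - (β + (β₁ + ct * β)) * (R * cr) * cr)⁻¹ * Real.exp (-(ρ₂ * g.dist y y')))) := by
  have hβb : 0 ≤ β + (β₁ + ct * β) := by positivity
  have hG := hasMaj_smoothCut_flat blk (S := S) hβ hβ₁ hct hχt hsub hcut
  have hD := hasMaj_jet_smoothCut_flat blk τ n (S := S) hβ hβ₁ hct hχt hdχt hdχtb hs hsb hdd hddb hcut hcutF hcutB
  exact hasMaj_dressedV_loc₂ blk htri hd hrow hσ hβb hR hcr hσρ hρ₁V hρ₁G hρ₂ hρ₂₁ hSχ hSψ (smoothCut_out hχ) (smoothCut_in hNψ) (fun _ => rfl) hG hD hV hq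

/-- ★ **THE DRESSED CUBE IS ITS OWN CUT**: `M_{χ_□}∘X = X` (so FILE 63's `hGc : M_{χ_□}G_□ ≤ …` at `G_□ := X` is ★★★ itself), from the units and `χχ̃ = χ̃`, `N = NM_ψ`. [folklore] -/
theorem mulOp_comp_smoothCutDressed (hχ : mulOp (fun p : X × ι => χX p.1) ∘ₗ mulOp (fun p : X × ι => χtX p.1) = mulOp (fun p : X × ι => χtX p.1))
    (hNψ : N ∘ₗ mulOp (fun p : X × ι => ψX p.1) = N)
    (hunit : IsUnit (1 - LinearMap.toMatrix' (stack (mulOp (fun p : X × ι => χtX p.1) ∘ₗ N)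
      (fun j => Sum.elim (fun μ => fgrad n (liftEquiv (τ μ) ι)) (fun μ => bgrad n (liftEquiv (τ μ) ι)) j ∘ₗ (mulOp (fun p : X × ι => χtX p.1) ∘ₗ N)) ∘ₗ V))) :
    mulOp (fun p : X × ι => χX p.1) ∘ₗ (projO none ∘ₗ bgPropV (stack (mulOp (fun p : X × ι => χtX p.1) ∘ₗ N)
        (fun j => Sum.elim (fun μ => fgrad n (liftEquiv (τ μ) ι)) (fun μ => bgrad n (liftEquiv (τ μ) ι)) j ∘ₗ (mulOp (fun p : X × ι => χtX p.1) ∘ₗ N))) V) =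
      projO none ∘ₗ bgPropV (stack (mulOp (fun p : X × ι => χtX p.1) ∘ₗ N)
        (fun j => Sum.elim (fun μ => fgrad n (liftEquiv (τ μ) ι)) (fun μ => bgrad n (liftEquiv (τ μ) ι)) j ∘ₗ (mulOp (fun p : X × ι => χtX p.1) ∘ₗ N))) V := by
  have hχ0 : mulOp (fun p : X × ι => χX p.1) ∘ₗ (projO none ∘ₗ stack (mulOp (fun p : X × ι => χtX p.1) ∘ₗ N)
      (fun j => Sum.elim (fun μ => fgrad n (liftEquiv (τ μ) ι)) (fun μ => bgrad n (liftEquiv (τ μ) ι)) j ∘ₗ (mulOp (fun p : X × ι => χtX p.1) ∘ₗ N))) =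
      projO none ∘ₗ stack (mulOp (fun p : X × ι => χtX p.1) ∘ₗ N)
        (fun j => Sum.elim (fun μ => fgrad n (liftEquiv (τ μ) ι)) (fun μ => bgrad n (liftEquiv (τ μ) ι)) j ∘ₗ (mulOp (fun p : X × ι => χtX p.1) ∘ₗ N)) := by
    rw [projO_none_comp_stack]; exact smoothCut_out hχ
  exact (projO_dressedV_cutoffs (fun _ => rfl) hunit none hχ0 (smoothCut_in hNψ)).1

/-- ★★ **THE FORWARD LEFT ENTRIES OF THE DRESSED SMOOTH-CUT CUBE, TWO-SIDED** (FILE 58 `hDG` for `D := ∇⁺_μ`): under ★★★'s hypotheses plus the jet pieces' reversed insertions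
(`M_χM_{χ̃∘e} = M_{χ̃∘e}`, `M_χM_{∇χ̃} = M_{∇χ̃}`, both signs), `∇⁺_μ∘X ≤ 1_S1_S·β̄(1 − β̄Rc_r²)⁻¹e^{−ρ₂d}`. [cite: Balaban1985BackgroundPropagators, (3.42) p.397 (entry 1), (3.65) p.403 (mechanism); Balaban1984PropagatorsII, (2.133) p.247] -/
theorem hasMaj_fgrad_smoothCutDressed_loc₂ (htri : Triangle254 g) (hd : ∀ a b : g.Site, 0 ≤ g.dist a b) (hrow : RowSum g σ cr) (hσ : 0 ≤ σ) {ρ₁ ρ₂ δV R : ℝ} (hβ : 0 ≤ β)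
    (hβ₁ : 0 ≤ β₁) (hct : 0 ≤ ct) (hR : 0 ≤ R) (hcr : 0 ≤ cr) (hσρ : σ ≤ ρ₁) (hρ₁V : ρ₁ ≤ δV) (hρ₁G : ρ₁ + σ ≤ δ) (hρ₂ : 0 ≤ ρ₂) (hρ₂₁ : ρ₂ + σ ≤ ρ₁)
    (hSχ : ∀ x, χX x ≠ 0 → blk x ∈ S) (hSψ : ∀ x, ψX x ≠ 0 → blk x ∈ S) (hχt : ∀ x, |χtX x| ≤ 1)
    (hdχt : ∀ μ p, |fgrad n (liftEquiv (τ μ) ι) (fun p : X × ι => χtX p.1) p| ≤ ct) (hdχtb : ∀ μ p, |bgrad n (liftEquiv (τ μ) ι) (fun p : X × ι => χtX p.1) p| ≤ ct)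
    (hsub : mulOp (fun p : X × ι => χtX p.1) ∘ₗ mulOp (fun p : X × ι => χX p.1) = mulOp (fun p : X × ι => χtX p.1))
    (hs : ∀ μ, mulOp ((fun p : X × ι => χtX p.1) ∘ (liftEquiv (τ μ) ι)) ∘ₗ mulOp (fun p : X × ι => χX p.1) = mulOp ((fun p : X × ι => χtX p.1) ∘ (liftEquiv (τ μ) ι)))
    (hsb : ∀ μ, mulOp ((fun p : X × ι => χtX p.1) ∘ (liftEquiv (τ μ) ι).symm) ∘ₗ mulOp (fun p : X × ι => χX p.1) = mulOp ((fun p : X × ι => χtX p.1) ∘ (liftEquiv (τ μ) ι).symm))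
    (hdd : ∀ μ, mulOp (fgrad n (liftEquiv (τ μ) ι) (fun p : X × ι => χtX p.1)) ∘ₗ mulOp (fun p : X × ι => χX p.1) = mulOp (fgrad n (liftEquiv (τ μ) ι) (fun p : X × ι => χtX p.1)))
    (hddb : ∀ μ, mulOp (bgrad n (liftEquiv (τ μ) ι) (fun p : X × ι => χtX p.1)) ∘ₗ mulOp (fun p : X × ι => χX p.1) = mulOp (bgrad n (liftEquiv (τ μ) ι) (fun p : X × ι => χtX p.1)))
    (hs' : ∀ μ, mulOp (fun p : X × ι => χX p.1) ∘ₗ mulOp ((fun p : X × ι => χtX p.1) ∘ (liftEquiv (τ μ) ι)) = mulOp ((fun p : X × ι => χtX p.1) ∘ (liftEquiv (τ μ) ι)))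
    (hsb' : ∀ μ, mulOp (fun p : X × ι => χX p.1) ∘ₗ mulOp ((fun p : X × ι => χtX p.1) ∘ (liftEquiv (τ μ) ι).symm) = mulOp ((fun p : X × ι => χtX p.1) ∘ (liftEquiv (τ μ) ι).symm))
    (hdd' : ∀ μ, mulOp (fun p : X × ι => χX p.1) ∘ₗ mulOp (fgrad n (liftEquiv (τ μ) ι) (fun p : X × ι => χtX p.1)) = mulOp (fgrad n (liftEquiv (τ μ) ι) (fun p : X × ι => χtX p.1)))
    (hddb' : ∀ μ, mulOp (fun p : X × ι => χX p.1) ∘ₗ mulOp (bgrad n (liftEquiv (τ μ) ι) (fun p : X × ι => χtX p.1)) = mulOp (bgrad n (liftEquiv (τ μ) ι) (fun p : X × ι => χtX p.1)))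
    (hNψ : N ∘ₗ mulOp (fun p : X × ι => ψX p.1) = N)
    (hcut : HasMaj (BlockNorm.ofBlocks g (liftBlk blk ι)) (BlockNorm.ofBlocks g (liftBlk blk ι)) (mulOp (fun p : X × ι => χX p.1) ∘ₗ N)
      (fun y y' => ind S y * ind S y' * (β * Real.exp (-(δ * g.dist y y')))))
    (hcutF : ∀ μ, HasMaj (BlockNorm.ofBlocks g (liftBlk blk ι)) (BlockNorm.ofBlocks g (liftBlk blk ι)) (mulOp (fun p : X × ι => χX p.1) ∘ₗ (fgrad n (liftEquiv (τ μ) ι) ∘ₗ N))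
      (fun y y' => ind S y * ind S y' * (β₁ * Real.exp (-(δ * g.dist y y')))))
    (hcutB : ∀ μ, HasMaj (BlockNorm.ofBlocks g (liftBlk blk ι)) (BlockNorm.ofBlocks g (liftBlk blk ι)) (mulOp (fun p : X × ι => χX p.1) ∘ₗ (bgrad n (liftEquiv (τ μ) ι) ∘ₗ N))
      (fun y y' => ind S y * ind S y' * (β₁ * Real.exp (-(δ * g.dist y y')))))
    (hV : HasMaj (BlockNorm.ofBlocks g (blkPair (liftBlk blk ι))) (BlockNorm.ofBlocks g (liftBlk blk ι)) V (fun y y' => R * Real.exp (-(δV * g.dist y y'))))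
    (hq : (β + (β₁ + ct * β)) * (R * cr) * cr < 1) (μ : J) :
    HasMaj (BlockNorm.ofBlocks g (liftBlk blk ι)) (BlockNorm.ofBlocks g (liftBlk blk ι))
      (fgrad n (liftEquiv (τ μ) ι) ∘ₗ (projO none ∘ₗ bgPropV (stack (mulOp (fun p : X × ι => χtX p.1) ∘ₗ N)
        (fun j => Sum.elim (fun μ => fgrad n (liftEquiv (τ μ) ι)) (fun μ => bgrad n (liftEquiv (τ μ) ι)) j ∘ₗ (mulOp (fun p : X × ι => χtX p.1) ∘ₗ N))) V))
      (fun y y' => ind S y * ind S y' * ((β + (β₁ + ct * β)) * (1 - (β + (β₁ + ct * β)) * (R * cr) * cr)⁻¹ * Real.exp (-(ρ₂ * g.dist y y')))) := by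
  have hβb : 0 ≤ β + (β₁ + ct * β) := by positivity
  have hG := hasMaj_smoothCut_flat blk (S := S) hβ hβ₁ hct hχt hsub hcut
  have hD := hasMaj_jet_smoothCut_flat blk τ n (S := S) hβ hβ₁ hct hχt hdχt hdχtb hs hsb hdd hddb hcut hcutF hcutB
  obtain ⟨hunit, -⟩ := hasMaj_dressedV_pair blk htri hd hrow hσ hβb hR hcr hσρ hρ₁V hρ₁G hρ₂ hρ₂₁ hG hD hV hq
  have hout := jet_smoothCut_out τ n (N := N) hs hsb hdd hddb hs' hsb' hdd' hddb' (Sum.inl μ)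
  have hψ' : mulOp (fun p : X × ι => χX p.1) ∘ₗ (projO (some (Sum.inl μ)) ∘ₗ stack (mulOp (fun p : X × ι => χtX p.1) ∘ₗ N)
      (fun j => Sum.elim (fun μ => fgrad n (liftEquiv (τ μ) ι)) (fun μ => bgrad n (liftEquiv (τ μ) ι)) j ∘ₗ (mulOp (fun p : X × ι => χtX p.1) ∘ₗ N))) =
      projO (some (Sum.inl μ)) ∘ₗ stack (mulOp (fun p : X × ι => χtX p.1) ∘ₗ N)
        (fun j => Sum.elim (fun μ => fgrad n (liftEquiv (τ μ) ι)) (fun μ => bgrad n (liftEquiv (τ μ) ι)) j ∘ₗ (mulOp (fun p : X × ι => χtX p.1) ∘ₗ N)) := by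
    rw [projO_some_comp_stack]; exact hout
  have key := hasMaj_projO_dressedV_loc₂ blk htri hd hrow hσ hβb hR hcr hσρ hρ₁V hρ₁G hρ₂ hρ₂₁ (fun _ => rfl) (some (Sum.inl μ)) hSχ hSψ hψ' (smoothCut_in hNψ) hG hD hV hq
  rw [projO_some_dressedV (fun _ => rfl) hunit (Sum.inl μ), Sum.elim_inl] at key
  exact key

/-- ★★ **THE BACKWARD LEFT ENTRIES** `∇⁻_μ∘X ≤ 1_S1_S·β̄(1 − β̄Rc_r²)⁻¹e^{−ρ₂d}`. [cite: Balaban1985BackgroundPropagators, (3.42) p.397, (3.65) p.403; Balaban1984PropagatorsII, (2.133) p.247] -/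
theorem hasMaj_bgrad_smoothCutDressed_loc₂ (htri : Triangle254 g) (hd : ∀ a b : g.Site, 0 ≤ g.dist a b) (hrow : RowSum g σ cr) (hσ : 0 ≤ σ) {ρ₁ ρ₂ δV R : ℝ} (hβ : 0 ≤ β)
    (hβ₁ : 0 ≤ β₁) (hct : 0 ≤ ct) (hR : 0 ≤ R) (hcr : 0 ≤ cr) (hσρ : σ ≤ ρ₁) (hρ₁V : ρ₁ ≤ δV) (hρ₁G : ρ₁ + σ ≤ δ) (hρ₂ : 0 ≤ ρ₂) (hρ₂₁ : ρ₂ + σ ≤ ρ₁)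
    (hSχ : ∀ x, χX x ≠ 0 → blk x ∈ S) (hSψ : ∀ x, ψX x ≠ 0 → blk x ∈ S) (hχt : ∀ x, |χtX x| ≤ 1)
    (hdχt : ∀ μ p, |fgrad n (liftEquiv (τ μ) ι) (fun p : X × ι => χtX p.1) p| ≤ ct) (hdχtb : ∀ μ p, |bgrad n (liftEquiv (τ μ) ι) (fun p : X × ι => χtX p.1) p| ≤ ct)
    (hsub : mulOp (fun p : X × ι => χtX p.1) ∘ₗ mulOp (fun p : X × ι => χX p.1) = mulOp (fun p : X × ι => χtX p.1))
    (hs : ∀ μ, mulOp ((fun p : X × ι => χtX p.1) ∘ (liftEquiv (τ μ) ι)) ∘ₗ mulOp (fun p : X × ι => χX p.1) = mulOp ((fun p : X × ι => χtX p.1) ∘ (liftEquiv (τ μ) ι)))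
    (hsb : ∀ μ, mulOp ((fun p : X × ι => χtX p.1) ∘ (liftEquiv (τ μ) ι).symm) ∘ₗ mulOp (fun p : X × ι => χX p.1) = mulOp ((fun p : X × ι => χtX p.1) ∘ (liftEquiv (τ μ) ι).symm))
    (hdd : ∀ μ, mulOp (fgrad n (liftEquiv (τ μ) ι) (fun p : X × ι => χtX p.1)) ∘ₗ mulOp (fun p : X × ι => χX p.1) = mulOp (fgrad n (liftEquiv (τ μ) ι) (fun p : X × ι => χtX p.1)))
    (hddb : ∀ μ, mulOp (bgrad n (liftEquiv (τ μ) ι) (fun p : X × ι => χtX p.1)) ∘ₗ mulOp (fun p : X × ι => χX p.1) = mulOp (bgrad n (liftEquiv (τ μ) ι) (fun p : X × ι => χtX p.1)))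
    (hs' : ∀ μ, mulOp (fun p : X × ι => χX p.1) ∘ₗ mulOp ((fun p : X × ι => χtX p.1) ∘ (liftEquiv (τ μ) ι)) = mulOp ((fun p : X × ι => χtX p.1) ∘ (liftEquiv (τ μ) ι)))
    (hsb' : ∀ μ, mulOp (fun p : X × ι => χX p.1) ∘ₗ mulOp ((fun p : X × ι => χtX p.1) ∘ (liftEquiv (τ μ) ι).symm) = mulOp ((fun p : X × ι => χtX p.1) ∘ (liftEquiv (τ μ) ι).symm))
    (hdd' : ∀ μ, mulOp (fun p : X × ι => χX p.1) ∘ₗ mulOp (fgrad n (liftEquiv (τ μ) ι) (fun p : X × ι => χtX p.1)) = mulOp (fgrad n (liftEquiv (τ μ) ι) (fun p : X × ι => χtX p.1)))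
    (hddb' : ∀ μ, mulOp (fun p : X × ι => χX p.1) ∘ₗ mulOp (bgrad n (liftEquiv (τ μ) ι) (fun p : X × ι => χtX p.1)) = mulOp (bgrad n (liftEquiv (τ μ) ι) (fun p : X × ι => χtX p.1)))
    (hNψ : N ∘ₗ mulOp (fun p : X × ι => ψX p.1) = N)
    (hcut : HasMaj (BlockNorm.ofBlocks g (liftBlk blk ι)) (BlockNorm.ofBlocks g (liftBlk blk ι)) (mulOp (fun p : X × ι => χX p.1) ∘ₗ N)
      (fun y y' => ind S y * ind S y' * (β * Real.exp (-(δ * g.dist y y')))))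
    (hcutF : ∀ μ, HasMaj (BlockNorm.ofBlocks g (liftBlk blk ι)) (BlockNorm.ofBlocks g (liftBlk blk ι)) (mulOp (fun p : X × ι => χX p.1) ∘ₗ (fgrad n (liftEquiv (τ μ) ι) ∘ₗ N))
      (fun y y' => ind S y * ind S y' * (β₁ * Real.exp (-(δ * g.dist y y')))))
    (hcutB : ∀ μ, HasMaj (BlockNorm.ofBlocks g (liftBlk blk ι)) (BlockNorm.ofBlocks g (liftBlk blk ι)) (mulOp (fun p : X × ι => χX p.1) ∘ₗ (bgrad n (liftEquiv (τ μ) ι) ∘ₗ N))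
      (fun y y' => ind S y * ind S y' * (β₁ * Real.exp (-(δ * g.dist y y')))))
    (hV : HasMaj (BlockNorm.ofBlocks g (blkPair (liftBlk blk ι))) (BlockNorm.ofBlocks g (liftBlk blk ι)) V (fun y y' => R * Real.exp (-(δV * g.dist y y'))))
    (hq : (β + (β₁ + ct * β)) * (R * cr) * cr < 1) (μ : J) :
    HasMaj (BlockNorm.ofBlocks g (liftBlk blk ι)) (BlockNorm.ofBlocks g (liftBlk blk ι))
      (bgrad n (liftEquiv (τ μ) ι) ∘ₗ (projO none ∘ₗ bgPropV (stack (mulOp (fun p : X × ι => χtX p.1) ∘ₗ N)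
        (fun j => Sum.elim (fun μ => fgrad n (liftEquiv (τ μ) ι)) (fun μ => bgrad n (liftEquiv (τ μ) ι)) j ∘ₗ (mulOp (fun p : X × ι => χtX p.1) ∘ₗ N))) V))
      (fun y y' => ind S y * ind S y' * ((β + (β₁ + ct * β)) * (1 - (β + (β₁ + ct * β)) * (R * cr) * cr)⁻¹ * Real.exp (-(ρ₂ * g.dist y y')))) := by
  have hβb : 0 ≤ β + (β₁ + ct * β) := by positivity
  have hG := hasMaj_smoothCut_flat blk (S := S) hβ hβ₁ hct hχt hsub hcut
  have hD := hasMaj_jet_smoothCut_flat blk τ n (S := S) hβ hβ₁ hct hχt hdχt hdχtb hs hsb hdd hddb hcut hcutF hcutB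
  obtain ⟨hunit, -⟩ := hasMaj_dressedV_pair blk htri hd hrow hσ hβb hR hcr hσρ hρ₁V hρ₁G hρ₂ hρ₂₁ hG hD hV hq
  have hout := jet_smoothCut_out τ n (N := N) hs hsb hdd hddb hs' hsb' hdd' hddb' (Sum.inr μ)
  have hψ' : mulOp (fun p : X × ι => χX p.1) ∘ₗ (projO (some (Sum.inr μ)) ∘ₗ stack (mulOp (fun p : X × ι => χtX p.1) ∘ₗ N)
      (fun j => Sum.elim (fun μ => fgrad n (liftEquiv (τ μ) ι)) (fun μ => bgrad n (liftEquiv (τ μ) ι)) j ∘ₗ (mulOp (fun p : X × ι => χtX p.1) ∘ₗ N))) =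
      projO (some (Sum.inr μ)) ∘ₗ stack (mulOp (fun p : X × ι => χtX p.1) ∘ₗ N)
        (fun j => Sum.elim (fun μ => fgrad n (liftEquiv (τ μ) ι)) (fun μ => bgrad n (liftEquiv (τ μ) ι)) j ∘ₗ (mulOp (fun p : X × ι => χtX p.1) ∘ₗ N)) := by
    rw [projO_some_comp_stack]; exact hout
  have key := hasMaj_projO_dressedV_loc₂ blk htri hd hrow hσ hβb hR hcr hσρ hρ₁V hρ₁G hρ₂ hρ₂₁ (fun _ => rfl) (some (Sum.inr μ)) hSχ hSψ hψ' (smoothCut_in hNψ) hG hD hV hq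
  rw [projO_some_dressedV (fun _ => rfl) hunit (Sum.inr μ), Sum.elim_inr] at key
  exact key

end Summit.QuantumFields.YangMills.BalabanUVNodes.N15.CurvedSpecies

end
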